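import Mathlib.Data.Nat.Choose.Vandermonde
import Mathlib.LinearAlgebra.Matrix.ToLinearEquiv
import Summits.CriticalPhenomena.PercolationContinuityZ3.Theorems.PercNearOneGluingNoHeavyLowerTailAntiBandDetCriterion

/-!
# `NoHeavyLowerTail` (crux stmt-CriticalPhenomena-4575), lane prim-ineq-gen-4 (gen 27): (AB_l) for upper sets without members of size `< l − 1` — ALL `l`, ALL `|β| ≥ 2l`

Support file (`--supports stmt-CriticalPhenomena-4575`; memo `run/shared/lean/prim/prim-ineq-gen-4/FINDING-OFFDIAG-UNIVERSAL-g27.md` §0(5)(a)).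
No definitions, no `sorry`, standard axioms.

THE SINGLE-LEVEL CASE OF THE DETERMINANT CRITERION, uniformly in all parameters.  For `k`-subsets `x, x'` of `β` (`|β| ≥ 2k+1`, `N := |β| − 1 − 2k`)
Vandermonde's identity gives
`C(|β| − 1 − #(x ∪ x'), k) = C(N + #(x ∩ x'), k) = ∑_{i+j=k} C(N, i) · C(#(x ∩ x'), j) = ∑_{i+j=k} C(N, i) · #{z : #z = j, z ⊆ x, z ⊆ x'}`,
so on any family `U` of `k`-sets the binomial matrix `M_U = [C(|β|−1−#(x∪x'), k)]` is a NONNEGATIVE combination of Gram matrices `B_jᵀ B_j` of the incidence matrices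
`B_j[z,x] = [z ⊆ x]` (`#z = j`), and the `j = k` term (coefficient `C(N,0) = 1`) is the identity: `vᵀ M_U v ≥ ∑_x v_x² > 0` for `v ≠ 0`.  Hence `M_U` is positive definite,
`det M_U ≠ 0` (`det_binomial_ne_zero_of_card_eq`), and by the determinant criterion of gen 21 (`AntiBandDetCriterion.antiBand_of_det_binomial_ne_zero`):

**THEOREM (`antiBand_of_le_card`).**  For every `l ≥ 1`, every finite `β` with `2l ≤ |β|`, every upper set `A` all of whose members have size `≥ l − 1`, and every upper set `V`:
`#{s ∈ A ∩ Vᶜˢ : #s < l ∨ #sᶜ < l} ≤ #{s ∈ A ∩ V : #s < l ∨ #sᶜ < l}`   — the anti-band inequality (AB_l) for this class, in every dimension.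
(Previously in the tree: l = 2 (Lemma J), the degenerate class (`AntiBandDegenerate`), and the cells with a prime power `q > l−1` dividing `|β|−2l+1` (`AntiBandModP`).)
-/

namespace Summit.CriticalPhenomena.PercolationContinuityZ3.Theorems.AntiBandSingleLevel

open Finset Matrix
open scoped FinsetFamily

variable {β : Type*} [DecidableEq β] [Fintype β]

/-- The `j`-subsets of `univ` below a finset `s` are exactly the `j`-subsets of `s`. [elementary] -/
theorem filter_powersetCard_univ_subset (j : ℕ) (s : Finset β) :
    ((univ : Finset β).powersetCard j).filter (fun z => z ⊆ s) = s.powersetCard j := by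
  ext z
  rw [mem_filter, mem_powersetCard, mem_powersetCard]
  constructor
  · rintro ⟨⟨-, hz⟩, hzs⟩; exact ⟨hzs, hz⟩
  · rintro ⟨hzs, hz⟩; exact ⟨⟨subset_univ _, hz⟩, hzs⟩

/-- Gram entry of the level-`j` incidence matrix: `∑_{#z = j} [z ⊆ x][z ⊆ x'] = C(#(x ∩ x'), j)`. [elementary] -/
theorem sum_powersetCard_indicator_mul (j : ℕ) (x x' : Finset β) :
    ∑ z ∈ (univ : Finset β).powersetCard j, ((if z ⊆ x then (1 : ℤ) else 0) * (if z ⊆ x' then (1 : ℤ) else 0))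
      = ((#(x ∩ x')).choose j : ℤ) := by
  have h1 : ∑ z ∈ (univ : Finset β).powersetCard j, ((if z ⊆ x then (1 : ℤ) else 0) * (if z ⊆ x' then (1 : ℤ) else 0))
      = ∑ z ∈ (univ : Finset β).powersetCard j, (if z ⊆ x ∩ x' then (1 : ℤ) else 0) := by
    apply Finset.sum_congr rfl
    intro z _
    by_cases h1 : z ⊆ x <;> by_cases h2 : z ⊆ x'
    · have h3 : z ⊆ x ∩ x' := Finset.subset_inter h1 h2
      simp [h1, h2, h3]
    · have h3 : ¬ z ⊆ x ∩ x' := fun h => h2 (h.trans inter_subset_right)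
      simp [h1, h2, h3]
    · have h3 : ¬ z ⊆ x ∩ x' := fun h => h1 (h.trans inter_subset_left)
      simp [h1, h2, h3]
    · have h3 : ¬ z ⊆ x ∩ x' := fun h => h1 (h.trans inter_subset_left)
      simp [h1, h2, h3]
  rw [h1, Finset.sum_boole, filter_powersetCard_univ_subset, Finset.card_powersetCard]

/-- **The binomial matrix on a family of `k`-sets is positive definite; in particular `det ≠ 0`.**  For `U` a family of `k`-subsets of `β` with
`2k + 1 ≤ |β|`: `det [C(|β| − 1 − #(x ∪ x'), k)]_{x,x' ∈ U} ≠ 0`.  Proof: Vandermonde decomposition into incidence Grams (module docstring).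
[gen 27, memo §0(5)(a); all parameters] -/
theorem det_binomial_ne_zero_of_card_eq (k : ℕ) (U : Finset (Finset β)) (hU : ∀ x ∈ U, #x = k)
    (hβ : 2 * k + 1 ≤ Fintype.card β) :
    (Matrix.of fun (x x' : ↥U) => ((Fintype.card β - 1 - #((x : Finset β) ∪ x')).choose k : ℤ)).det ≠ 0 := by
  classical
  set n := Fintype.card β with hn
  set Nn := n - 1 - 2 * k with hNn
  set M : Matrix ↥U ↥U ℤ := Matrix.of fun (x x' : ↥U) => ((n - 1 - #((x : Finset β) ∪ x')).choose k : ℤ) with hMdef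
  -- the level-`j` incidence matrices
  set B : (j : ℕ) → Matrix ↥((univ : Finset β).powersetCard j) ↥U ℤ :=
    fun j => Matrix.of fun z x => if (z : Finset β) ⊆ (x : Finset β) then (1 : ℤ) else 0 with hBdef
  -- Vandermonde decomposition of `M`
  have hdec : M = ∑ ij ∈ antidiagonal k, ((Nn.choose ij.1 : ℤ) • ((B ij.2)ᵀ * B ij.2)) := by
    ext x x'
    rw [Matrix.sum_apply]
    simp only [hMdef, hBdef, Matrix.smul_apply, Matrix.mul_apply, transpose_apply, of_apply, smul_eq_mul]
    have hx := hU x x.2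
    have hx' := hU x' x'.2
    have hui : #((x : Finset β) ∪ x') + #((x : Finset β) ∩ x') = 2 * k := by
      rw [Finset.card_union_add_card_inter, hx, hx']; ring
    have hle : #((x : Finset β) ∪ x') ≤ 2 * k := by omega
    have e : n - 1 - #((x : Finset β) ∪ x') = Nn + #((x : Finset β) ∩ x') := by omega
    rw [e, Nat.add_choose_eq, Nat.cast_sum]
    apply Finset.sum_congr rfl
    intro ij _
    rw [Nat.cast_mul]
    congr 1
    rw [← sum_powersetCard_indicator_mul ij.2 (x : Finset β) x']
    rw [univ_eq_attach, Finset.sum_attach ((univ : Finset β).powersetCard ij.2)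
      (fun z => (if z ⊆ (x : Finset β) then (1 : ℤ) else 0) * (if z ⊆ (x' : Finset β) then (1 : ℤ) else 0))]
  -- the quadratic form is a nonnegative combination of squares, the `(0,k)` term being `∑ v²`
  have hquad : ∀ v : ↥U → ℤ, v ⬝ᵥ (M *ᵥ v) = ∑ ij ∈ antidiagonal k, (Nn.choose ij.1 : ℤ) * ((B ij.2 *ᵥ v) ⬝ᵥ (B ij.2 *ᵥ v)) := by
    intro v
    rw [hdec, Matrix.sum_mulVec, dotProduct_sum]
    apply Finset.sum_congr rfl
    intro ij _
    rw [Matrix.smul_mulVec, dotProduct_smul, smul_eq_mul, ← Matrix.mulVec_mulVec, Matrix.dotProduct_mulVec, Matrix.vecMul_transpose]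
  have hpos : ∀ v : ↥U → ℤ, v ≠ 0 → 0 < v ⬝ᵥ (M *ᵥ v) := by
    intro v hv
    obtain ⟨x₀, hx₀⟩ : ∃ x₀ : ↥U, v x₀ ≠ 0 := by
      by_contra h
      exact hv (funext fun x => not_not.mp (not_exists.mp h x))
    rw [hquad]
    have hterm : ∀ ij ∈ antidiagonal k, 0 ≤ (Nn.choose ij.1 : ℤ) * ((B ij.2 *ᵥ v) ⬝ᵥ (B ij.2 *ᵥ v)) := by
      intro ij _
      apply mul_nonneg (by positivity)
      unfold dotProduct
      exact Finset.sum_nonneg (fun z _ => mul_self_nonneg _)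
    have hmem : ((0, k) : ℕ × ℕ) ∈ antidiagonal k := by simp [mem_antidiagonal]
    refine lt_of_lt_of_le ?_ (Finset.single_le_sum hterm hmem)
    rw [Nat.choose_zero_right, Nat.cast_one, one_mul]
    -- the `k`-level incidence vector of `v` at `x₀` is `v x₀`
    have hx₀k : #(x₀ : Finset β) = k := hU x₀ x₀.2
    have hz₀ : (x₀ : Finset β) ∈ (univ : Finset β).powersetCard k := by
      rw [mem_powersetCard]; exact ⟨subset_univ _, hx₀k⟩
    have hBv : (B k *ᵥ v) ⟨(x₀ : Finset β), hz₀⟩ = v x₀ := by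
      simp only [hBdef, Matrix.mulVec, dotProduct, of_apply]
      rw [Finset.sum_eq_single x₀]
      · simp
      · intro x _ hne
        have hsub : ¬ (x₀ : Finset β) ⊆ (x : Finset β) := by
          intro h
          apply hne
          have := Finset.eq_of_subset_of_card_le h (by rw [hU x x.2, hx₀k])
          exact Subtype.ext this.symm
        simp [hsub]
      · intro h; exact absurd (mem_univ _) h
    unfold dotProduct
    refine lt_of_lt_of_le ?_ (Finset.single_le_sum (fun z _ => mul_self_nonneg ((B k *ᵥ v) z)) (mem_univ ⟨(x₀ : Finset β), hz₀⟩))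
    rw [hBv]
    exact lt_of_le_of_ne (mul_self_nonneg _) (Ne.symm (mul_ne_zero hx₀ hx₀))
  -- positive definite ⇒ nonsingular
  intro hdet
  obtain ⟨v, hv, hMv⟩ := Matrix.exists_mulVec_eq_zero_iff.mpr hdet
  have h := hpos v hv
  rw [hMv, dotProduct_zero] at h
  exact lt_irrefl _ h

/-- **(AB_l) for upper sets with no member of size `< l − 1` — every `l ≥ 1`, every `|β| ≥ 2l`.**  If `A`, `V` are upper sets of finsets of `β`,
`2l ≤ |β|`, and every member of `A` has size `≥ l − 1`, then `#{s ∈ A ∩ Vᶜˢ | #s < l ∨ #sᶜ < l} ≤ #{s ∈ A ∩ V | #s < l ∨ #sᶜ < l}`.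
Proof: the small members of `A` all have size exactly `l − 1`, so the binomial matrix of the determinant criterion is positive definite
(`det_binomial_ne_zero_of_card_eq`); conclude by `AntiBandDetCriterion.antiBand_of_det_binomial_ne_zero` (gen 21). [gen 27; all parameters] -/
theorem antiBand_of_le_card (l : ℕ) (hl : 1 ≤ l) (A V : Finset (Finset β))
    (hA : IsUpperSet (A : Set (Finset β))) (hV : IsUpperSet (V : Set (Finset β))) (hβ : 2 * l ≤ Fintype.card β)
    (hmin : ∀ s ∈ A, l - 1 ≤ #s) :
    #((A ∩ Vᶜˢ).filter fun s => #s < l ∨ #sᶜ < l) ≤ #((A ∩ V).filter fun s => #s < l ∨ #sᶜ < l) := by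
  apply AntiBandDetCriterion.antiBand_of_det_binomial_ne_zero l hl A V hA hV hβ
  apply det_binomial_ne_zero_of_card_eq (l - 1) (A.filter fun s => #s < l)
  · intro x hx
    rw [mem_filter] at hx
    have := hmin x hx.1
    omega
  · omega

end Summit.CriticalPhenomena.PercolationContinuityZ3.Theorems.AntiBandSingleLevel

/-!
## Second part (gen 27): one set below the top level — ALL `k ≥ 1`, ALL `|β| ≥ 2k+2`

For `U = 𝒰 ∪ {y}` with `𝒰` a family of `k`-sets containing every `k`-superset of the `(k−1)`-set `y`, the binomial matrix `M_U` is still nonsingular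
(`AntiBandOneBelow.det_binomial_ne_zero_of_one_below`, file `…AntiBandOneBelow.lean`; this file holds the two lemmas it needs): a null vector `c` has `c_y ≠ 0` by positive definiteness on the `k`-sets, and then positive SEMI-definiteness on the `k`-sets,
tested on the vector `q'·(c − c_y e_y) + c_y·C·1_S` (`S` = the `μ = |β| − k + 1` supersets of `y`; `C = C(N+k,k)`, `C' = C(N+k−1,k)`, `C'' = C(N+k+1,k)`,
`q' = C + (μ−1)C'`, `N = |β| − 2k − 1`) yields `q'·C'' ≥ μ·C²`, whereas `μC²(N+1)(N+k) − q'C''(N+1)(N+k) = k·C² > 0` (`sunflower_choose_ineq`) — the sunflower bound of memo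
FINDING-OFFDIAG-UNIVERSAL-g27 §0(5).  Consequence (`AntiBandOneBelow.antiBand_of_one_below`): (AB_l) for every `l ≥ 2`, `|β| ≥ 2l`, every upper set `A` whose members of size `< l` are
`(l−1)`-sets and at most ONE `(l−2)`-set — the first mixed-level class proved in every dimension.
-/

namespace Summit.CriticalPhenomena.PercolationContinuityZ3.Theorems.AntiBandSingleLevel

open Finset Matrix
open scoped FinsetFamily

variable {β : Type*} [DecidableEq β] [Fintype β]

/-- The number of `m`-subsets of `β` containing a fixed finset `w` with `#w ≤ m` is `C(|β| − #w, m − #w)`. [elementary; same statement as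
`AntiBandMiddleLevel.card_filter_powersetCard_superset`, private copy to keep this file independent of that module] -/
private theorem card_filter_powersetCard_superset' (w : Finset β) (m : ℕ) (hw : #w ≤ m) :
    #(((univ : Finset β).powersetCard m).filter (fun y => w ⊆ y)) = (Fintype.card β - #w).choose (m - #w) := by
  rw [← Finset.card_compl w, ← Finset.card_powersetCard (m - #w) wᶜ]
  symm
  apply Finset.card_bij' (fun u _ => u ∪ w) (fun y _ => y \ w)
  · intro u hu
    rw [mem_powersetCard] at hu
    have hdisj : Disjoint u w := by
      rw [← Finset.subset_compl_iff_disjoint_right]; exact hu.1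
    rw [mem_filter, mem_powersetCard]
    refine ⟨⟨subset_univ _, ?_⟩, subset_union_right⟩
    rw [card_union_of_disjoint hdisj, hu.2]
    omega
  · intro y hy
    rw [mem_filter, mem_powersetCard] at hy
    rw [mem_powersetCard]
    refine ⟨?_, ?_⟩
    · intro a ha
      rw [mem_sdiff] at ha
      rw [mem_compl]
      exact ha.2
    · rw [card_sdiff_of_subset hy.2, hy.1.2]
  · intro u hu
    rw [mem_powersetCard] at hu
    have hdisj : Disjoint u w := by
      rw [← Finset.subset_compl_iff_disjoint_right]; exact hu.1
    exact Finset.union_sdiff_cancel_right hdisj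
  · intro y hy
    rw [mem_filter] at hy
    exact Finset.sdiff_union_of_subset hy.2

/-- Positive semidefiniteness of the binomial matrix on vectors supported on the `k`-sets of an arbitrary family `U` (`2k+1 ≤ |β|`), strict for non-zero such
vectors.  Vandermonde decomposition as in `det_binomial_ne_zero_of_card_eq`, with the indicator of `#x = k` built into the incidence matrices. [gen 27] -/
theorem quadForm_binomial_nonneg_and_pos (k : ℕ) (U : Finset (Finset β)) (hβ : 2 * k + 1 ≤ Fintype.card β)
    (v : ↥U → ℤ) (hv : ∀ x : ↥U, #(x : Finset β) ≠ k → v x = 0) :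
    0 ≤ v ⬝ᵥ ((Matrix.of fun (x x' : ↥U) => ((Fintype.card β - 1 - #((x : Finset β) ∪ x')).choose k : ℤ)) *ᵥ v)
    ∧ ((∃ x : ↥U, v x ≠ 0) → 0 < v ⬝ᵥ ((Matrix.of fun (x x' : ↥U) => ((Fintype.card β - 1 - #((x : Finset β) ∪ x')).choose k : ℤ)) *ᵥ v)) := by
  classical
  set n := Fintype.card β with hn
  set Nn := n - 1 - 2 * k with hNn
  set M : Matrix ↥U ↥U ℤ := Matrix.of fun (x x' : ↥U) => ((n - 1 - #((x : Finset β) ∪ x')).choose k : ℤ) with hMdef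
  set B : (j : ℕ) → Matrix ↥((univ : Finset β).powersetCard j) ↥U ℤ :=
    fun j => Matrix.of fun z x => if #(x : Finset β) = k ∧ (z : Finset β) ⊆ (x : Finset β) then (1 : ℤ) else 0 with hBdef
  set M0 : Matrix ↥U ↥U ℤ := ∑ ij ∈ antidiagonal k, ((Nn.choose ij.1 : ℤ) • ((B ij.2)ᵀ * B ij.2)) with hM0def
  have hM0 : ∀ x x' : ↥U, M0 x x' = if #(x : Finset β) = k ∧ #(x' : Finset β) = k then M x x' else 0 := by
    intro x x'
    rw [hM0def, Matrix.sum_apply]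
    simp only [hBdef, Matrix.smul_apply, Matrix.mul_apply, transpose_apply, of_apply, smul_eq_mul]
    by_cases hxx : #(x : Finset β) = k ∧ #(x' : Finset β) = k
    · rw [if_pos hxx, hMdef, of_apply]
      obtain ⟨hx, hx'⟩ := hxx
      have hui : #((x : Finset β) ∪ x') + #((x : Finset β) ∩ x') = 2 * k := by
        rw [Finset.card_union_add_card_inter, hx, hx']; ring
      have e : n - 1 - #((x : Finset β) ∪ x') = Nn + #((x : Finset β) ∩ x') := by omega
      rw [e, Nat.add_choose_eq, Nat.cast_sum]
      apply Finset.sum_congr rfl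
      intro ij _
      rw [Nat.cast_mul]
      congr 1
      simp only [hx, hx', true_and]
      rw [← sum_powersetCard_indicator_mul ij.2 (x : Finset β) x']
      rw [univ_eq_attach, Finset.sum_attach ((univ : Finset β).powersetCard ij.2)
        (fun z => (if z ⊆ (x : Finset β) then (1 : ℤ) else 0) * (if z ⊆ (x' : Finset β) then (1 : ℤ) else 0))]
    · rw [if_neg hxx]
      apply Finset.sum_eq_zero
      intro ij _
      rw [mul_eq_zero]; right
      apply Finset.sum_eq_zero
      intro z _
      by_cases h1 : #(x : Finset β) = k
      · have h2 : ¬ #(x' : Finset β) = k := fun h => hxx ⟨h1, h⟩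
        simp [h2]
      · simp [h1]
  have hforms : v ⬝ᵥ (M *ᵥ v) = v ⬝ᵥ (M0 *ᵥ v) := by
    simp only [dotProduct, Matrix.mulVec]
    apply Finset.sum_congr rfl
    intro x _
    by_cases hx : #(x : Finset β) = k
    · congr 1
      apply Finset.sum_congr rfl
      intro x' _
      by_cases hx' : #(x' : Finset β) = k
      · rw [hM0 x x', if_pos ⟨hx, hx'⟩]
      · rw [hv x' hx', mul_zero, mul_zero]
    · rw [hv x hx, zero_mul, zero_mul]
  have hquad : v ⬝ᵥ (M0 *ᵥ v) = ∑ ij ∈ antidiagonal k, (Nn.choose ij.1 : ℤ) * ((B ij.2 *ᵥ v) ⬝ᵥ (B ij.2 *ᵥ v)) := by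
    rw [hM0def, Matrix.sum_mulVec, dotProduct_sum]
    apply Finset.sum_congr rfl
    intro ij _
    rw [Matrix.smul_mulVec, dotProduct_smul, smul_eq_mul, ← Matrix.mulVec_mulVec, Matrix.dotProduct_mulVec, Matrix.vecMul_transpose]
  have hterm : ∀ ij ∈ antidiagonal k, 0 ≤ (Nn.choose ij.1 : ℤ) * ((B ij.2 *ᵥ v) ⬝ᵥ (B ij.2 *ᵥ v)) := by
    intro ij _
    apply mul_nonneg (by positivity)
    unfold dotProduct
    exact Finset.sum_nonneg (fun z _ => mul_self_nonneg _)
  refine ⟨?_, ?_⟩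
  · rw [hforms, hquad]
    exact Finset.sum_nonneg hterm
  · rintro ⟨x₀, hx₀⟩
    have hx₀k : #(x₀ : Finset β) = k := by
      by_contra h
      exact hx₀ (hv x₀ h)
    rw [hforms, hquad]
    have hmem : ((0, k) : ℕ × ℕ) ∈ antidiagonal k := by simp [mem_antidiagonal]
    refine lt_of_lt_of_le ?_ (Finset.single_le_sum hterm hmem)
    rw [Nat.choose_zero_right, Nat.cast_one, one_mul]
    have hz₀ : (x₀ : Finset β) ∈ (univ : Finset β).powersetCard k := by
      rw [mem_powersetCard]; exact ⟨subset_univ _, hx₀k⟩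
    have hBv : (B k *ᵥ v) ⟨(x₀ : Finset β), hz₀⟩ = v x₀ := by
      simp only [hBdef, Matrix.mulVec, dotProduct, of_apply]
      rw [Finset.sum_eq_single x₀]
      · simp [hx₀k]
      · intro x _ hne
        by_cases hxk : #(x : Finset β) = k
        · have hsub : ¬ (x₀ : Finset β) ⊆ (x : Finset β) := by
            intro h
            apply hne
            have := Finset.eq_of_subset_of_card_le h (by rw [hxk, hx₀k])
            exact Subtype.ext this.symm
          simp [hsub]
        · simp [hxk]
      · intro h; exact absurd (mem_univ _) h
    unfold dotProduct
    refine lt_of_lt_of_le ?_ (Finset.single_le_sum (fun z _ => mul_self_nonneg ((B k *ᵥ v) z)) (mem_univ ⟨(x₀ : Finset β), hz₀⟩))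
    rw [hBv]
    exact lt_of_le_of_ne (mul_self_nonneg _) (Ne.symm (mul_ne_zero hx₀ hx₀))

omit [DecidableEq β] [Fintype β] in
/-- The sunflower inequality: with `C = C(N+k,k)`, `C' = C(N+k−1,k)`, `C'' = C(N+k+1,k)` and `N, k ≥ 1`,
`(C + (N+k+1)·C')·C'' < (N+k+2)·C²` (indeed the difference times `(N+1)(N+k)` is exactly `k·C²`). [gen 27, elementary] -/
theorem sunflower_choose_ineq (N k : ℕ) (hN : 1 ≤ N) (hk : 1 ≤ k) :
    (((N + k).choose k : ℤ) + ((N : ℤ) + k + 1) * ((N + k - 1).choose k : ℤ)) * ((N + k + 1).choose k : ℤ)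
      < ((N : ℤ) + k + 2) * ((N + k).choose k : ℤ) ^ 2 := by
  have h1 : ((N + k + 1).choose k : ℤ) * ((N : ℤ) + 1) = ((N + k).choose k : ℤ) * ((N : ℤ) + k + 1) := by
    have h := Nat.choose_mul_succ_eq (N + k) k
    have e : N + k + 1 - k = N + 1 := by omega
    rw [e] at h
    have h' := congrArg (fun m : ℕ => (m : ℤ)) h
    push_cast at h'
    linarith
  have h2 : ((N + k - 1).choose k : ℤ) * ((N : ℤ) + k) = ((N + k).choose k : ℤ) * (N : ℤ) := by
    have h := Nat.choose_mul_succ_eq (N + k - 1) k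
    have e1 : N + k - 1 + 1 = N + k := by omega
    have e2 : N + k - k = N := by omega
    rw [e1, e2] at h
    have h' := congrArg (fun m : ℕ => (m : ℤ)) h
    push_cast at h'
    linarith
  set C := ((N + k).choose k : ℤ) with hCdef
  set C' := ((N + k - 1).choose k : ℤ) with hC'def
  set C'' := ((N + k + 1).choose k : ℤ) with hC''def
  have hC : (0 : ℤ) < C := by
    have : 0 < (N + k).choose k := Nat.choose_pos (by omega)
    rw [hCdef]; exact_mod_cast this
  have hNpos : (0 : ℤ) < (N : ℤ) := by exact_mod_cast hN
  have hkpos : (0 : ℤ) < (k : ℤ) := by exact_mod_cast hk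
  have key : (((N : ℤ) + k + 2) * C ^ 2 - (C + ((N : ℤ) + k + 1) * C') * C'') * (((N : ℤ) + 1) * ((N : ℤ) + k))
      = (k : ℤ) * C ^ 2 := by
    have expand : (((N : ℤ) + k + 2) * C ^ 2 - (C + ((N : ℤ) + k + 1) * C') * C'') * (((N : ℤ) + 1) * ((N : ℤ) + k))
        = ((N : ℤ) + k + 2) * C ^ 2 * (((N : ℤ) + 1) * ((N : ℤ) + k)) - C * ((N : ℤ) + k) * (C'' * ((N : ℤ) + 1))
          - ((N : ℤ) + k + 1) * (C' * ((N : ℤ) + k)) * (C'' * ((N : ℤ) + 1)) := by ring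
    rw [expand, h1, h2]
    ring
  have hpos : (0 : ℤ) < (k : ℤ) * C ^ 2 := by positivity
  by_contra hcon
  rw [not_lt] at hcon
  have hnonpos : (((N : ℤ) + k + 2) * C ^ 2 - (C + ((N : ℤ) + k + 1) * C') * C'') * (((N : ℤ) + 1) * ((N : ℤ) + k)) ≤ 0 := by
    apply mul_nonpos_of_nonpos_of_nonneg
    · linarith
    · positivity
  linarith

end Summit.CriticalPhenomena.PercolationContinuityZ3.Theorems.AntiBandSingleLevel
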